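import Mathlib
import HarnessLib
import Summits.Ventures.LatticeQCDFlow.Scoring.AllPairsAcceptanceRatioConsistency
import Summits.Ventures.LatticeQCDFlow.Scoring.UStatisticCLT

/-!
# ASYMPTOTIC NORMALITY of the printed acceptance ratio: `√n (Rₙ − acc(p, q)) ⇒ N(0, 4ζ₁)` with
# `ζ₁ = Var_q[h(y) − acc·(w(y) + 1)/2]`, `h(a) = E_q min(w(a), w(y′))` — Hoeffding's U-statistic
# CLT for the mean-zero kernel `min(w, w′) − acc·(w + w′)/2` plus Slutsky for the denominator

HONEST FRAMING: exact (Metropolis-corrected) sampling algorithms for lattice gauge theory;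
figures of merit are autocorrelation/cost numbers at stated couplings and volumes; no
continuum-physics claim.

Venture `LatticeQCDFlow` (cell pub-lqcd), topic `Scoring`; FANOUT row 4 (`s0-u1-b`, rung S0-B).
Sequel of `Scoring/UStatisticCLT` (Hoeffding's CLT for order-2 U-statistics) and
`Scoring/AllPairsAcceptanceRatioConsistency` (`Rₙ → acc` a.s., `W̄ₙ → 1`), both imported.  The
printed ratio of one proposal stream (weights `w̃ = c·w`, `w = p/q`, `c > 0`) is
`Rₙ = Ûₙ/W̄ₙ`, `Ûₙ = Σ_{i≠j<n} min(w̃ᵢ, w̃ⱼ)/(n(n−1))`, `W̄ₙ = Σ_{j<n} w̃ⱼ/n`; the key observation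
is that `W̄ₙ` is ITSELF an order-2 U-statistic, of the kernel `(w + w′)/2`, so
`Ûₙ − acc·W̄ₙ = Uₙ(F′)` for the symmetric kernel
`F′(a, b) = min(w(a), w(b)) − (acc/2)(w(a) + w(b))`, which has MEAN ZERO under the model pair
law (`E min(w, w′) = acc`, `E w = 1`) and is square-integrable as soon as `p²/q ∈ L¹(μ)` (a
positive ESS).  Hoeffding's CLT
(`CardConsistency.ustat₂_clt`) gives `√n·Uₙ(F′) ⇒ 2Y`, `Y ∼ N(0, ζ₁(F′))`,
`ζ₁(F′) = ∫ (∫ F′(a, b) dν(b))² dν(a)`; and `√n (Rₙ − acc) = √n·Uₙ(F′)/W̄ₙ` with `W̄ₙ → 1`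
almost surely, so Slutsky (`continuous_comp_prodMk_of_tendstoInMeasure_const` with
`g(x, w) = x/max(w, ½)`, then `tendstoInDistribution_of_tendstoInMeasure_sub`) gives
`√n (Rₙ − acc) ⇒ 2Y`.  NEW WORK of the cell (elementary given the two imported files); no
definition is introduced; nothing is cited as a fact.

## Content (`ν = μ.withDensity q`; `w = p/q`; `acc = ∫∫ min(p(a)q(b), p(b)q(a)) dμ dμ`;
## `F′(a, b) = min(w(a), w(b)) − (acc/2)(w(a) + w(b))`)

* `memLp_fst_snd_of_memLp` (`g ∈ L²(ν)` ⇒ `g∘fst, g∘snd ∈ L²(ν ⊗ ν)`), `measurable_accKernel`,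
  `accKernel_symm`, `memLp_accKernel_two`, **`integral_accKernel_eq_zero`** (mean zero);
* `sum_offDiag_add_eq` (`Σ_{i≠j}(wᵢ + wⱼ) = 2(n − 1)Σᵢ wᵢ`), **`acceptanceRatio_sqrt_eq`** (the
  algebra `√n(Rₙ − acc) = √n·Uₙ(F′)/max(W̄ₙ, ½)` when `W̄ₙ > ½`, `n ≥ 2`, any `c > 0`);
* **`printedAcceptance_clt`** — for any `Y` with law `N(0, ζ₁(F′))`:
  `TendstoInDistribution (n ↦ √n (Rₙ − acc)) atTop (2·Y)`.

NOT CLAIMED: the case ESS `= 0` (`w ∉ L²`: the kernel `F′` is then not square-integrable and the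
`√n` rate can fail); a Berry–Esseen rate; a studentised version (the printed acceptance column
carries no error bar in the card); any number of ours re-scored.
-/

noncomputable section

namespace Summit.Ventures.LatticeQCDFlow.Scoring.CardConsistency

open MeasureTheory ProbabilityTheory Finset Real Filter
open scoped Topology Function

/-! ## §1 The mean-zero acceptance kernel under the model pair law -/

section Kernel

variable {X : Type*} [MeasurableSpace X] {μ : Measure X} [SFinite μ] {p q : X → ℝ}

omit [SFinite μ] in
/-- `g ∈ L²(ν)` for a probability law `ν` ⇒ `g∘fst, g∘snd ∈ L²(ν ⊗ ν)`. [folklore] -/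
theorem memLp_fst_snd_of_memLp {ν : Measure X} [IsProbabilityMeasure ν] {g : X → ℝ}
    (hg : MemLp g 2 ν) :
    MemLp (fun z : X × X => g z.1) 2 (ν.prod ν) ∧ MemLp (fun z : X × X => g z.2) 2 (ν.prod ν) := by
  constructor
  · have h : MemLp g 2 (Measure.map Prod.fst (ν.prod ν)) := by
      rw [Measure.map_fst_prod, measure_univ, one_smul]
      exact hg
    exact h.comp_of_map measurable_fst.aemeasurable
  · have h : MemLp g 2 (Measure.map Prod.snd (ν.prod ν)) := by
      rw [Measure.map_snd_prod, measure_univ, one_smul]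
      exact hg
    exact h.comp_of_map measurable_snd.aemeasurable

omit [SFinite μ] in
/-- The kernel `F′(a, b) = min(w(a), w(b)) − (acc/2)(w(a) + w(b))` is measurable. [ours] -/
theorem measurable_accKernel (hpm : Measurable p) (hqm : Measurable q) (acc : ℝ) :
    Measurable fun z : X × X =>
      min (p z.1 / q z.1) (p z.2 / q z.2) - acc / 2 * (p z.1 / q z.1 + p z.2 / q z.2) := by
  have hwm : Measurable fun a => p a / q a := hpm.div hqm
  exact (PairedDraws.measurable_pairMin hpm hqm).sub
    (((hwm.comp measurable_fst).add (hwm.comp measurable_snd)).const_mul _)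

omit [MeasurableSpace X] [SFinite μ] in
/-- The kernel `F′` is symmetric. [ours] -/
theorem accKernel_symm (acc : ℝ) (a b : X) :
    min (p a / q a) (p b / q b) - acc / 2 * (p a / q a + p b / q b)
      = min (p b / q b) (p a / q a) - acc / 2 * (p b / q b + p a / q a) := by
  rw [min_comm, add_comm]

/-- **`F′ ∈ L²((q dμ) ⊗ (q dμ))`** when `p²/q ∈ L¹(μ)` (the `min` part needs nothing). [ours] -/
theorem memLp_accKernel_two
    (hν : IsProbabilityMeasure (μ.withDensity fun z => ENNReal.ofReal (q z)))
    (hp0 : ∀ z, 0 ≤ p z) (hpm : Measurable p) (hpi : Integrable p μ) (hq0 : ∀ z, 0 < q z)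
    (hqm : Measurable q) (hM2i : Integrable (fun z => p z ^ 2 / q z) μ) (acc : ℝ) :
    MemLp (fun z : X × X =>
      min (p z.1 / q z.1) (p z.2 / q z.2) - acc / 2 * (p z.1 / q z.1 + p z.2 / q z.2)) 2
      ((μ.withDensity fun z => ENNReal.ofReal (q z)).prod
        (μ.withDensity fun z => ENNReal.ofReal (q z))) := by
  obtain ⟨h1, h2⟩ := memLp_fst_snd_of_memLp (AllPairsMedian.memLp_weight_model hpm hq0 hqm hM2i)
  exact (AllPairsVariance.memLp_pairMin_two hp0 hpm hpi hq0 hqm).sub ((h1.add h2).const_mul _)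

/-- **`F′` HAS MEAN ZERO under the model pair law**: `E min(w, w′) = acc`, `E w = E w′ = 1`.
[ours] -/
theorem integral_accKernel_eq_zero
    (hν : IsProbabilityMeasure (μ.withDensity fun z => ENNReal.ofReal (q z)))
    (hp0 : ∀ z, 0 ≤ p z) (hpm : Measurable p) (hpi : Integrable p μ) (hp1 : ∫ z, p z ∂μ = 1)
    (hq0 : ∀ z, 0 < q z) (hqm : Measurable q) (hqi : Integrable q μ)
    (hM2i : Integrable (fun z => p z ^ 2 / q z) μ) :
    ∫ z, (min (p z.1 / q z.1) (p z.2 / q z.2)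
        - (∫ a, ∫ b, min (p a * q b) (p b * q a) ∂μ ∂μ) / 2 * (p z.1 / q z.1 + p z.2 / q z.2))
      ∂((μ.withDensity fun z => ENNReal.ofReal (q z)).prod
        (μ.withDensity fun z => ENNReal.ofReal (q z))) = 0 := by
  obtain ⟨h1, h2⟩ := memLp_fst_snd_of_memLp (AllPairsMedian.memLp_weight_model hpm hq0 hqm hM2i)
  have hmin : Integrable (fun z : X × X => min (p z.1 / q z.1) (p z.2 / q z.2))
      ((μ.withDensity fun z => ENNReal.ofReal (q z)).prod
        (μ.withDensity fun z => ENNReal.ofReal (q z))) :=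
    (AllPairsVariance.memLp_pairMin_two hp0 hpm hpi hq0 hqm).integrable one_le_two
  have h1i := h1.integrable one_le_two
  have h2i := h2.integrable one_le_two
  have hw := AllPairsVariance.integral_weight_withDensity_eq (μ := μ) hpi hq0 hqm
  have hsum : Integrable (fun z : X × X =>
      (∫ a, ∫ b, min (p a * q b) (p b * q a) ∂μ ∂μ) / 2 * (p z.1 / q z.1 + p z.2 / q z.2))
      ((μ.withDensity fun z => ENNReal.ofReal (q z)).prod
        (μ.withDensity fun z => ENNReal.ofReal (q z))) := (h1i.add h2i).const_mul _
  rw [integral_sub hmin hsum, integral_const_mul, integral_add h1i h2i,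
    integral_fun_fst (fun a => p a / q a), integral_fun_snd (fun a => p a / q a), hw.2, hp1,
    AllPairsVariance.integral_pairMin_withDensity_eq_meanAccept hp0 hpm hpi hq0 hqm hqi,
    probReal_univ]
  ring

end Kernel

/-! ## §2 The algebra: `W̄ₙ` is the U-statistic of `(w + w′)/2`, and `√n(Rₙ − acc)` -/

section Algebra

variable {X : Type*} {p q : X → ℝ}

/-- `Σ_{i ≠ j} (wᵢ + wⱼ) = 2(n − 1)·Σᵢ wᵢ` over `Fin n`. [ours] -/
theorem sum_offDiag_add_eq {n : ℕ} (f : Fin n → ℝ) :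
    ∑ z ∈ (univ : Finset (Fin n)).offDiag, (f z.1 + f z.2) = 2 * ((n : ℝ) - 1) * ∑ i, f i := by
  rw [sum_add_distrib, sum_offDiag_fst, sum_offDiag_snd, card_univ, Fintype.card_fin]
  ring

/-- **The algebra behind Slutsky**: weights printed as `w̃ = c·w` (`c > 0`), `n ≥ 2`, and
`W̄ₙ = Σⱼ wⱼ/n > ½`; then
`√n·(Rₙ − acc) = √n·Uₙ(F′)/max(W̄ₙ, ½)` with `Uₙ(F′) = Σ_{i≠j} F′(yᵢ, yⱼ)/(n(n − 1))`. [ours] -/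
theorem acceptanceRatio_sqrt_eq {wt : X → ℝ} {c : ℝ} (hc : 0 < c)
    (hwt : ∀ z, wt z = c * (p z / q z)) (v : ℕ → X) (acc : ℝ) {n : ℕ} (hn : 2 ≤ n)
    (hW : (1 : ℝ) / 2 < (∑ j : Fin n, p (v j) / q (v j)) / n) :
    Real.sqrt n * (((∑ z ∈ (univ : Finset (Fin n)).offDiag, min (wt (v z.1)) (wt (v z.2)))
        / (n * (n - 1) : ℝ)) / ((∑ j : Fin n, wt (v j)) / n) - acc)
      = Real.sqrt n * ((∑ z ∈ (univ : Finset (Fin n)).offDiag,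
          (min (p (v z.1) / q (v z.1)) (p (v z.2) / q (v z.2))
            - acc / 2 * (p (v z.1) / q (v z.1) + p (v z.2) / q (v z.2)))) / (n * (n - 1) : ℝ))
        / max ((∑ j : Fin n, p (v j) / q (v j)) / n) (1 / 2) := by
  have h2 : (2 : ℝ) ≤ n := by exact_mod_cast hn
  have hn0 : (0 : ℝ) < n := by linarith
  have hn1 : (n : ℝ) - 1 ≠ 0 := by
    intro h
    linarith
  have hB : 0 < ∑ j : Fin n, p (v j) / q (v j) := by
    have h : (0 : ℝ) < (∑ j : Fin n, p (v j) / q (v j)) / n := by linarith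
    exact (div_pos_iff_of_pos_right hn0).1 h
  rw [AllPairsMedian.blockRatio_scale_free hc hwt (fun i : Fin n => v i), max_eq_left hW.le,
    sum_sub_distrib, ← mul_sum, sum_offDiag_add_eq (fun i : Fin n => p (v i) / q (v i))]
  field_simp

end Algebra

/-! ## §3 The central limit theorem for the printed acceptance ratio -/

section CLT

variable {Ω : Type*} [MeasurableSpace Ω] {P : Measure Ω} [IsProbabilityMeasure P]
variable {Ω' : Type*} [MeasurableSpace Ω'] {P' : Measure Ω'} [IsProbabilityMeasure P']
variable {X : Type*} [MeasurableSpace X] {μ : Measure X} [SFinite μ] {p q : X → ℝ}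
variable {y : ℕ → Ω → X} {Y : Ω' → ℝ}

/-- **ASYMPTOTIC NORMALITY OF THE PRINTED ACCEPTANCE RATIO.**  One independent proposal stream
`yᵢ` (laws `ν = μ.withDensity q`); `p ≥ 0` measurable, integrable, `∫ p dμ = 1`, `p²/q ∈ L¹(μ)`
(a positive ESS); `q > 0` measurable, integrable; weights printed with ANY normalisation
`w̃ = c·p/q`, `c > 0`; `Y` any real random variable with law `N(0, ζ₁)`,
`ζ₁ = ∫ (∫ F′(a, b) dν(b))² dν(a)` for the mean-zero kernel
`F′(a, b) = min(w(a), w(b)) − (acc/2)(w(a) + w(b))`, `acc = ∫∫ min(p(a)q(b), p(b)q(a)) dμ dμ`.  Then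
`√n·(Rₙ − acc) ⇒ 2·Y` in distribution, `Rₙ` the printed all-pairs acceptance ratio. [ours] -/
theorem printedAcceptance_clt (hym : ∀ j, Measurable (y j)) (hind : iIndepFun y P)
    (hlaw : ∀ j, Measure.map (y j) P = μ.withDensity fun z => ENNReal.ofReal (q z))
    (hp0 : ∀ z, 0 ≤ p z) (hpm : Measurable p) (hpi : Integrable p μ) (hp1 : ∫ z, p z ∂μ = 1)
    (hq0 : ∀ z, 0 < q z) (hqm : Measurable q) (hqi : Integrable q μ)
    (hM2i : Integrable (fun z => p z ^ 2 / q z) μ) {wt : X → ℝ} {c : ℝ} (hc : 0 < c)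
    (hwt : ∀ z, wt z = c * (p z / q z))
    (hY : HasLaw Y (gaussianReal 0 (∫ a, (∫ b, (min (p a / q a) (p b / q b)
        - (∫ a', ∫ b', min (p a' * q b') (p b' * q a') ∂μ ∂μ) / 2 * (p a / q a + p b / q b))
        ∂(μ.withDensity fun z => ENNReal.ofReal (q z))) ^ 2
        ∂(μ.withDensity fun z => ENNReal.ofReal (q z))).toNNReal) P') :
    TendstoInDistribution (fun (n : ℕ) ω => Real.sqrt n *
        (((∑ z ∈ (univ : Finset (Fin n)).offDiag, min (wt (y z.1 ω)) (wt (y z.2 ω)))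
            / (n * (n - 1) : ℝ)) / ((∑ j : Fin n, wt (y j ω)) / n)
          - ∫ a, ∫ b, min (p a * q b) (p b * q a) ∂μ ∂μ))
      atTop (fun ω' => 2 * Y ω') (fun _ => P) P' := by
  haveI hν : IsProbabilityMeasure (μ.withDensity fun z => ENNReal.ofReal (q z)) := by
    rw [← hlaw 0]
    exact Measure.isProbabilityMeasure_map (hym 0).aemeasurable
  obtain ⟨acc, hacc⟩ : ∃ acc : ℝ, acc = ∫ a, ∫ b, min (p a * q b) (p b * q a) ∂μ ∂μ := ⟨_, rfl⟩
  rw [← hacc] at hY ⊢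
  have hwm : Measurable fun a => p a / q a := hpm.div hqm
  have hwtm : Measurable wt := by
    have h : wt = fun z => c * (p z / q z) := funext hwt
    rw [h]
    exact hwm.const_mul c
  -- the mean-zero kernel and Hoeffding's CLT for it
  have hFm := measurable_accKernel (X := X) hpm hqm acc
  have hF2 := memLp_accKernel_two (μ := μ) hν hp0 hpm hpi hq0 hqm hM2i acc
  have hmean : ∫ z, (min (p z.1 / q z.1) (p z.2 / q z.2)
      - acc / 2 * (p z.1 / q z.1 + p z.2 / q z.2))
      ∂((μ.withDensity fun z => ENNReal.ofReal (q z)).prod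
        (μ.withDensity fun z => ENNReal.ofReal (q z))) = 0 := by
    rw [hacc]
    exact integral_accKernel_eq_zero hν hp0 hpm hpi hp1 hq0 hqm hqi hM2i
  have hY' : HasLaw Y (gaussianReal 0 ((∫ a, (∫ b, (min (p a / q a) (p b / q b)
      - acc / 2 * (p a / q a + p b / q b)) ∂(μ.withDensity fun z => ENNReal.ofReal (q z))) ^ 2
      ∂(μ.withDensity fun z => ENNReal.ofReal (q z)))
      - (∫ z, (min (p z.1 / q z.1) (p z.2 / q z.2) - acc / 2 * (p z.1 / q z.1 + p z.2 / q z.2))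
        ∂((μ.withDensity fun z => ENNReal.ofReal (q z)).prod
          (μ.withDensity fun z => ENNReal.ofReal (q z)))) ^ 2).toNNReal) P' := by
    rw [hmean, zero_pow two_ne_zero, sub_zero]
    exact hY
  have hU := ustat₂_clt (P := P) (P' := P') hym hind hlaw
    (F := fun a b => min (p a / q a) (p b / q b) - acc / 2 * (p a / q a + p b / q b))
    hFm (accKernel_symm acc) hF2 hY'
  rw [hmean] at hU
  simp only [sub_zero] at hU
  -- the mean weight tends to `1` in probability
  have hWm : ∀ n : ℕ, Measurable fun ω => (∑ j : Fin n, p (y j ω) / q (y j ω)) / n := fun n =>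
    (Finset.measurable_sum _ fun (j : Fin n) _ => hwm.comp (hym j)).div_const _
  have hWae := meanWeight_fin_tendsto_one_ae hym hind hlaw hpm hpi hp1 hq0 hqm
  have hW : TendstoInMeasure P (fun (n : ℕ) ω => (∑ j : Fin n, p (y j ω) / q (y j ω)) / n)
      atTop (fun _ => (1 : ℝ)) :=
    tendstoInMeasure_of_tendsto_ae (fun n => (hWm n).aestronglyMeasurable) hWae
  -- Slutsky with `g(x, w) = x / max(w, ½)`
  have hgc : Continuous fun z : ℝ × ℝ => z.1 / max z.2 (1 / 2) :=
    continuous_fst.div (continuous_snd.max continuous_const)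
      fun z => (lt_max_of_lt_right (by norm_num : (0 : ℝ) < 1 / 2)).ne'
  have hsl := hU.continuous_comp_prodMk_of_tendstoInMeasure_const hgc hW
    (fun n => (hWm n).aemeasurable)
  have elim : (fun ω' => 2 * Y ω' / max (1 : ℝ) (1 / 2)) = fun ω' => 2 * Y ω' := by
    funext ω'
    rw [max_eq_left (by norm_num), div_one]
  rw [elim] at hsl
  -- the printed statistic agrees with the Slutsky statistic eventually, almost surely
  have hUm : ∀ n : ℕ, Measurable fun ω => Real.sqrt n *
      ((∑ z ∈ (univ : Finset (Fin n)).offDiag,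
          (min (p (y z.1 ω) / q (y z.1 ω)) (p (y z.2 ω) / q (y z.2 ω))
            - acc / 2 * (p (y z.1 ω) / q (y z.1 ω) + p (y z.2 ω) / q (y z.2 ω))))
        / (n * (n - 1) : ℝ)) := fun n =>
    (measurable_ustat₂_iid (x := fun (i : Fin n) ω => y i ω) (fun i => hym _)
      (F := fun a b => min (p a / q a) (p b / q b) - acc / 2 * (p a / q a + p b / q b))
      hFm).const_mul _
  have hRm : ∀ n : ℕ, Measurable fun ω => Real.sqrt n *
      (((∑ z ∈ (univ : Finset (Fin n)).offDiag, min (wt (y z.1 ω)) (wt (y z.2 ω)))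
          / (n * (n - 1) : ℝ)) / ((∑ j : Fin n, wt (y j ω)) / n) - acc) := fun n =>
    (((measurable_ustat₂_iid (x := fun (i : Fin n) ω => y i ω) (fun i => hym _)
      (F := fun a b => min (wt a) (wt b))
      ((hwtm.comp measurable_fst).min (hwtm.comp measurable_snd))).div
      ((Finset.measurable_sum _ fun (j : Fin n) _ => hwtm.comp (hym j)).div_const _)).sub_const
      acc).const_mul _
  refine tendstoInDistribution_of_tendstoInMeasure_sub (μ'' := P) (μ' := P') _ _ hsl ?_
    (fun n => (hRm n).aemeasurable)
  refine tendstoInMeasure_of_tendsto_ae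
    (fun n => ((hRm n).sub ((hUm n).div ((hWm n).max measurable_const))).aestronglyMeasurable) ?_
  filter_upwards [hWae] with ω hWω
  have hpos : ∀ᶠ n : ℕ in atTop, (1 : ℝ) / 2 < (∑ j : Fin n, p (y j ω) / q (y j ω)) / n :=
    hWω.eventually_const_lt (by norm_num)
  refine (tendsto_const_nhds (x := (0 : ℝ))).congr' ?_
  filter_upwards [hpos, eventually_ge_atTop 2] with n hn hn2
  rw [Pi.sub_apply, Pi.sub_apply, acceptanceRatio_sqrt_eq hc hwt (fun i => y i ω) acc hn2 hn,
    sub_self]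

end CLT

end Summit.Ventures.LatticeQCDFlow.Scoring.CardConsistency

end
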